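import Summits.MatrixMultiplication.OmegaCensus.SmallFormats.MatMul22nCheapFunctionalsCensus
import HarnessLib

/-!
# ω-census family (a): a 2-dimensional cheap plane PINS the Y-forms of its ≤ 4 terms (any field)

Cell `pub-omega` (unit `pub-omega-tensor`, gen 39), topic `Summits/MatrixMultiplication/OmegaCensus` (sub-folder
`SmallFormats`). Framing (verbatim): lottery ticket; floor = certified bounds/negative ranges. HONEST FRAMING: the paper step «README
§Derived» of tensor g39's prescribed-marginal SAT instrument (kitjob-all4sat, `LD` variants) in the kernel; an elementary structural
lemma about bilinear computations `XY = ∑ f_t(X) g_t(Y) W_t` of `⟨2,2,n⟩` over any field; nothing on `ω`.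

**`CheapSpans.gRow_mem_span`.** Let `S` be a set of at most `4` indices and `c₀, c₁ ∈ kⁿ` linearly independent output columns that
are CHEAP for `S` with respect to a nonzero output row combination `ν`: `∑_i c_m(i) (ν ᵥ* W_t)_i = 0` for every `t ∉ S` (this is what
`CheapCensus.cheapFunctionals_rowPlane` (p728768) provides for a loaded row plane at length `3n+3`). Then for every `s ∈ S` and each
row index `κ`, the coefficient row `(g_s(E_{κ j}))_j` of the Y-form `g_s` is a linear combination of `c₀, c₁`.

Proof: applying the output functional `θ_m : Z ↦ ∑_i c_m(i)(ν ᵥ* Z)_i` to the identity `XY = ∑ f_t(X) g_t(Y) W_t` kills every `t ∉ S`;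
with `X = ν_{j₀}⁻¹ E_{j₀ κ}` one gets `θ_m(XY) = ∑_i c_m(i) Y_{κ i}`, so the four linearly independent Y-forms `Y ↦ ∑_i c_m(i) Y_{κ i}`
(`κ, m ∈ {0,1}`) lie in the span of the `≤ 4` forms `g_s`, `s ∈ S`; by dimension the two spans coincide, and expanding `g_s` in the basis
`{∑_i c_m(i) Y_{κ i}}` gives the claim. (`|S| = 3` analogue used by the encoder — the two forms `Y ↦ ∑_i c(i) Y_{κ i}` lie in
`span{g_s}` — is `rowForm_eq_sum` below.)
-/

namespace Summit.MatrixMultiplication.OmegaCensus.SmallFormats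

open Finset Module Matrix
open Literature.Computability.AlgebraicComplexity

namespace CheapSpans

variable {k : Type*} [Field k] {n : ℕ} {ι : Type*} [Fintype ι]

/-- The substitution `X = ν_{j₀}⁻¹ E_{j₀ κ}` turns the output functional `Z ↦ ∑_i c_i (ν ᵥ* Z)_i` into the row form
`Y ↦ ∑_i c_i Y_{κ i}`. -/
theorem outSum_single_mul (ν : Fin 2 → k) {j₀ : Fin 2} (hj₀ : ν j₀ ≠ 0) (κ : Fin 2) (c : Fin n → k)
    (Y : Matrix (Fin 2) (Fin n) k) :
    ∑ i, c i * (Matrix.vecMul ν (((ν j₀)⁻¹ • Matrix.single j₀ κ (1 : k)) * Y)) i = ∑ i, c i * Y κ i := by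
  refine Finset.sum_congr rfl fun i _ => ?_
  congr 1
  simp only [Matrix.vecMul, dotProduct, Matrix.smul_mul, Matrix.smul_apply, smul_eq_mul]
  rw [Finset.sum_eq_single j₀]
  · rw [Matrix.mul_apply, Finset.sum_eq_single κ]
    · simp [hj₀]
    · intro l _ hl; simp [Ne.symm hl]
    · intro h; exact absurd (Finset.mem_univ κ) h
  · intro j _ hj
    rw [Matrix.mul_apply]
    simp [Ne.symm hj]
  · intro h; exact absurd (Finset.mem_univ j₀) h

/-- **One cheap output column** (§Derived, `|S| = 3` clause, coefficient form): if `∑_i c_i (ν ᵥ* W_t)_i = 0` for all `t ∉ S`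
(`ν ≠ 0`), then for each `κ` the Y-form `Y ↦ ∑_i c_i Y_{κ i}` equals `∑_{t ∈ S} a_t g_t` for explicit coefficients `a`. -/
theorem rowForm_eq_sum (β : BilinComp (mulBilin k 2 2 n) ι) (ν : Fin 2 → k) (hν : ν ≠ 0) (S : Finset ι)
    (c : Fin n → k) (hcheap : ∀ t, t ∉ S → ∑ i, c i * (Matrix.vecMul ν (β.w t)) i = 0) (κ : Fin 2) :
    ∃ a : ι → k, ∀ Y : Matrix (Fin 2) (Fin n) k, ∑ i, c i * Y κ i = ∑ t ∈ S, a t * β.g t Y := by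
  classical
  obtain ⟨j₀, hj₀⟩ : ∃ j₀, ν j₀ ≠ 0 := Function.ne_iff.mp hν
  set X : Matrix (Fin 2) (Fin 2) k := (ν j₀)⁻¹ • Matrix.single j₀ κ (1 : k) with hX
  -- the output functional θ(Z) = ∑_i c_i (ν ᵥ* Z)_i as a linear map
  let θ : Module.Dual k (Matrix (Fin 2) (Fin n) k) :=
    { toFun := fun Z => ∑ i, c i * (Matrix.vecMul ν Z) i
      map_add' := fun Z Z' => by
        simp only [Matrix.vecMul_add, Pi.add_apply, mul_add, Finset.sum_add_distrib]
      map_smul' := fun a Z => by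
        simp only [Matrix.vecMul_smul, Pi.smul_apply, smul_eq_mul, RingHom.id_apply, Finset.mul_sum]
        exact Finset.sum_congr rfl fun i _ => by ring }
  have hθ : ∀ Z, θ Z = ∑ i, c i * (Matrix.vecMul ν Z) i := fun Z => rfl
  refine ⟨fun t => β.f t X * θ (β.w t), fun Y => ?_⟩
  rw [← outSum_single_mul ν hj₀ κ c Y, ← hX, ← hθ]
  have e := β.map_eq_sum X Y
  rw [mulBilin_apply] at e
  rw [e, map_sum]
  simp only [map_smul, smul_eq_mul]
  rw [← Finset.sum_subset (Finset.subset_univ S)]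
  · exact Finset.sum_congr rfl fun t _ => by ring
  · intro t _ ht
    rw [hθ, hcheap t ht]; ring

/-- **A 2-dimensional cheap plane pins the Y-forms of its `≤ 4` terms** (§Derived, `|S| = 4` clause): with `c 0, c 1` linearly
independent and cheap for `S` w.r.t. `ν ≠ 0` (`∑_i c_m(i) (ν ᵥ* W_t)_i = 0` for `t ∉ S`, as provided by
`CheapCensus.cheapFunctionals_rowPlane`), and `|S| ≤ 4`, every coefficient row `(g_s(E_{κ j}))_j` (`s ∈ S`, `κ ∈ {0,1}`) is a linear
combination of `c 0, c 1`. -/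
theorem gRow_mem_span (β : BilinComp (mulBilin k 2 2 n) ι) (ν : Fin 2 → k) (hν : ν ≠ 0) (S : Finset ι) (hS4 : S.card ≤ 4)
    (c : Fin 2 → (Fin n → k)) (hind : ∀ a : Fin 2 → k, ∑ m, a m • c m = 0 → ∀ m, a m = 0)
    (hcheap : ∀ t, t ∉ S → ∀ m, ∑ i, c m i * (Matrix.vecMul ν (β.w t)) i = 0) :
    ∀ s ∈ S, ∀ κ : Fin 2, ∃ a : Fin 2 → k, (fun j => β.g s (Matrix.single κ j (1 : k))) = ∑ m, a m • c m := by
  classical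
  -- the row forms Φ (κ, m) : Y ↦ ∑_i c_m(i) Y_{κ i}
  let Φ : Fin 2 × Fin 2 → Module.Dual k (Matrix (Fin 2) (Fin n) k) := fun p =>
    { toFun := fun Y => ∑ i, c p.2 i * Y p.1 i
      map_add' := fun Y Y' => by simp only [Matrix.add_apply, mul_add, Finset.sum_add_distrib]
      map_smul' := fun a Y => by
        simp only [Matrix.smul_apply, smul_eq_mul, RingHom.id_apply, Finset.mul_sum]
        exact Finset.sum_congr rfl fun i _ => by ring }
  have hΦapp : ∀ p Y, Φ p Y = ∑ i, c p.2 i * Y p.1 i := fun p Y => rfl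
  have hΦsingle : ∀ p (κ' : Fin 2) (j : Fin n), Φ p (Matrix.single κ' j (1 : k)) = if p.1 = κ' then c p.2 j else 0 := by
    intro p κ' j
    rw [hΦapp]
    by_cases h : p.1 = κ'
    · rw [if_pos h, h, Finset.sum_eq_single j]
      · simp
      · intro i _ hi; simp [Ne.symm hi]
      · intro hj; exact absurd (Finset.mem_univ j) hj
    · rw [if_neg h]
      exact Finset.sum_eq_zero fun i _ => by simp [Ne.symm h]
  let G : Submodule k (Module.Dual k (Matrix (Fin 2) (Fin n) k)) := Submodule.span k (Set.range fun s : S => β.g s)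
  let W₁ : Submodule k (Module.Dual k (Matrix (Fin 2) (Fin n) k)) := Submodule.span k (Set.range Φ)
  -- W₁ ≤ G
  have hle : W₁ ≤ G := by
    refine Submodule.span_le.mpr ?_
    rintro _ ⟨p, rfl⟩
    obtain ⟨a, ha⟩ := rowForm_eq_sum β ν hν S (c p.2) (fun t ht => hcheap t ht p.2) p.1
    have e : Φ p = ∑ t ∈ S, a t • β.g t := by
      apply LinearMap.ext; intro Y
      rw [hΦapp, ha, LinearMap.sum_apply]
      simp only [LinearMap.smul_apply, smul_eq_mul]
    change Φ p ∈ G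
    rw [e]
    exact Submodule.sum_mem _ fun t ht => Submodule.smul_mem _ _ (Submodule.subset_span ⟨⟨t, ht⟩, rfl⟩)
  -- Φ is linearly independent
  have hΦ : LinearIndependent k Φ := by
    rw [Fintype.linearIndependent_iff]
    intro g hg
    have hrow : ∀ κ' : Fin 2, ∑ m, g (κ', m) • c m = 0 := by
      intro κ'
      funext j
      have h := congrArg (fun ψ : Module.Dual k (Matrix (Fin 2) (Fin n) k) => ψ (Matrix.single κ' j (1 : k))) hg
      simp only [LinearMap.sum_apply, LinearMap.smul_apply, LinearMap.zero_apply, smul_eq_mul] at h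
      rw [Fintype.sum_prod_type] at h
      simp only [hΦsingle] at h
      rw [Fin.sum_univ_two] at h
      simp only [Pi.zero_apply, Finset.sum_apply, Pi.smul_apply, smul_eq_mul]
      fin_cases κ'
      · simpa using h
      · simpa using h
    rintro ⟨κ', m'⟩
    exact hind (fun m => g (κ', m)) (hrow κ') m'
  -- dimensions
  have hW₁ : finrank k W₁ = 4 := by
    rw [finrank_span_eq_card hΦ]; simp
  have hG : finrank k G ≤ 4 := (finrank_range_le_card _).trans (by simpa using hS4)
  have hEq : W₁ = G := Submodule.eq_of_le_of_finrank_le hle (by omega)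
  -- expand g_s in the basis Φ
  intro s hs κ
  have hmem : β.g s ∈ W₁ := by
    rw [hEq]; exact Submodule.subset_span ⟨⟨s, hs⟩, rfl⟩
  obtain ⟨coef, hcoef⟩ := (Submodule.mem_span_range_iff_exists_fun k).mp hmem
  refine ⟨fun m => coef (κ, m), ?_⟩
  funext j
  have h := congrArg (fun ψ : Module.Dual k (Matrix (Fin 2) (Fin n) k) => ψ (Matrix.single κ j (1 : k))) hcoef
  simp only [LinearMap.sum_apply, LinearMap.smul_apply, smul_eq_mul] at h
  rw [Fintype.sum_prod_type] at h
  simp only [hΦsingle] at h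
  rw [Fin.sum_univ_two] at h
  simp only [Finset.sum_apply, Pi.smul_apply, smul_eq_mul]
  rw [← h]
  fin_cases κ
  · simp
  · simp

end CheapSpans

end Summit.MatrixMultiplication.OmegaCensus.SmallFormats
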